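import Mathlib
import HarnessLib

/-!
# Format C: the entrywise bound for the digamma remainder part of the far Gram (DIG_off ρ-part)

Route context: Fourier–Galerkin / Schur-complement certificates of Weil positivity on a window ("format C";
cell memo `run/shared/lean/pub/rh-explicit/rh-explicit-weil-10/FORMATC-DESIGN.md` §4.3, DIG_off; supporting
stmt-RiemannHypothesis-0098).  The off-diagonal archimedean entries in a sector are `(n y_n − m y_m)/(π(n² − m²))`
(even; odd with `n, m` swapped in the numerator), `y_k = Im ψ(¼ + iω_k/2)`.  Writing `y_k = π/2 + ρ_k` splits them into
the Hilbert part `±½/(n+m)` (handled in `WeilFormatCHilbertPartBound.lean` / `…PSD.lean`) and the ρ-part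
`(n ρ_n − m ρ_m)/(π(n² − m²))`.  By the edge bound D1 (`WeilFormatCDigammaEdgeBounds.lean`) `|ρ_k| ≤ 2/ω_k = 2a/(πk)`, so
`|k ρ_k| ≤ 2a/π =: C` and the ρ-entries are `≤ (2C/π)/(|n−m|(n+m)) ≤ (2C/π)/(min(n,m)|n−m|)` — the hypothesis shape of the
Hilbert–Schmidt lemma `WeilFormatC.sum_sum_sq_le_of_offDiag_bound` (`WeilFormatCOffDiagHSBound.lean`).  THIS FILE is that
elementary step, with `ρ` an arbitrary real sequence:

* `WeilFormatC.abs_rho_entry_le` — `|k ρ_k| ≤ C` for `k = n, m`, `n ≠ m` positive ⟹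
  `|(n ρ_n − m ρ_m)/(π(n² − m²))| ≤ (2C/π)/(|n − m|·(n + m))`;
* `WeilFormatC.abs_rho_entry_le_min` — the same with `(n+m)` weakened to `min(n,m)`.

Elementary; standard axioms only.
-/

-- `Summit.RiemannHypothesis.RiemannHypothesis.…` is the layout-mandated namespace (summit = problem name).
set_option linter.dupNamespace false

namespace Summit.RiemannHypothesis.RiemannHypothesis.Theorems.WeilFormatC

/-- **ρ-part entry bound.**  If `|n ρ_n| ≤ C` and `|m ρ_m| ≤ C` with `n ≠ m` positive, then
`|(n ρ_n − m ρ_m)/(π(n² − m²))| ≤ (2C/π)/(|n − m|(n + m))`. -/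
theorem abs_rho_entry_le {n m : ℕ} (hn : 0 < n) (hm : 0 < m) (hnm : n ≠ m) (ρ : ℕ → ℝ) {C : ℝ}
    (hρn : |(n : ℝ) * ρ n| ≤ C) (hρm : |(m : ℝ) * ρ m| ≤ C) :
    |((n : ℝ) * ρ n - m * ρ m) / (Real.pi * ((n : ℝ) ^ 2 - m ^ 2))|
      ≤ (2 * C / Real.pi) / (|(n : ℝ) - m| * ((n : ℝ) + m)) := by
  have hπ : 0 < Real.pi := Real.pi_pos
  have hsum : (0 : ℝ) < n + m := by positivity
  have hdiff : (0 : ℝ) < |(n : ℝ) - m| := abs_pos.mpr (sub_ne_zero.mpr (by exact_mod_cast hnm))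
  have hnum : |(n : ℝ) * ρ n - m * ρ m| ≤ 2 * C := by
    have := abs_sub _ _ |>.trans (add_le_add hρn hρm)  -- |x - y| ≤ |x| + |y|
    linarith
  have hden : |Real.pi * ((n : ℝ) ^ 2 - m ^ 2)| = Real.pi * (|(n : ℝ) - m| * ((n : ℝ) + m)) := by
    rw [abs_mul, abs_of_pos hπ, show (n : ℝ) ^ 2 - m ^ 2 = ((n : ℝ) - m) * (n + m) by ring, abs_mul,
      abs_of_pos hsum]
  rw [abs_div, hden]
  -- 2C/π / D = 2C/(π D)
  rw [div_div]
  exact div_le_div_of_nonneg_right hnum (by positivity)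

/-- The same bound with `n + m` weakened to `min(n, m)` (the shape used by the Hilbert–Schmidt double-sum lemma). -/
theorem abs_rho_entry_le_min {n m : ℕ} (hn : 0 < n) (hm : 0 < m) (hnm : n ≠ m) (ρ : ℕ → ℝ) {C : ℝ}
    (hρn : |(n : ℝ) * ρ n| ≤ C) (hρm : |(m : ℝ) * ρ m| ≤ C) :
    |((n : ℝ) * ρ n - m * ρ m) / (Real.pi * ((n : ℝ) ^ 2 - m ^ 2))|
      ≤ (2 * C / Real.pi) / (((min n m : ℕ) : ℝ) * |(n : ℝ) - m|) := by
  refine (abs_rho_entry_le hn hm hnm ρ hρn hρm).trans ?_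
  have hπ : 0 < Real.pi := Real.pi_pos
  have hC : 0 ≤ C := le_trans (abs_nonneg _) hρn
  have hdiff : (0 : ℝ) < |(n : ℝ) - m| := abs_pos.mpr (sub_ne_zero.mpr (by exact_mod_cast hnm))
  have hmin0 : (0 : ℝ) < ((min n m : ℕ) : ℝ) := by
    have : 0 < min n m := lt_min hn hm; exact_mod_cast this
  have hminle : (((min n m : ℕ) : ℝ)) ≤ (n : ℝ) + m := by
    have : min n m ≤ n + m := (min_le_left n m).trans (Nat.le_add_right n m)
    exact_mod_cast this
  apply div_le_div_of_nonneg_left (by positivity) (by positivity)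
  calc ((min n m : ℕ) : ℝ) * |(n : ℝ) - m| ≤ ((n : ℝ) + m) * |(n : ℝ) - m| :=
        mul_le_mul_of_nonneg_right hminle hdiff.le
    _ = |(n : ℝ) - m| * ((n : ℝ) + m) := mul_comm _ _

end Summit.RiemannHypothesis.RiemannHypothesis.Theorems.WeilFormatC
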